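import Literature.Probability.RandomPlanarGeometry.SLESlopeOccupationFn
import Literature.Probability.RandomPlanarGeometry.SLECriticalGhat
import Literature.Probability.RandomPlanarGeometry.SLEPointFlowStopped
import Literature.Probability.Process.HittingFrom
import HarnessLib

/-!
# Level crossings and occupation functionals of the SLE slope after a stopping time

Topic `Probability/RandomPlanarGeometry`; theorems and small definitions. Two conditional
(strong-Markov-free) estimates for the slope `wₜ = xₜ/yₜ` of the centred SLE_κ flow at `z ∈ ℍ`,
`0 < κ < 8`, read on the flow stopped at `σ⋆ = T_S ∧ ρₙ` (`sleCotArgLocTime κ z S n`: exit of `|w|`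
from `[0, S)` capped by the localizing time `ρₙ`, `|w₀| < S`), for a stopping time `T ≤ σ⋆` and an
event `G ∈ 𝓕_T`:

* `measureReal_inter_hit_le` — **reaching the levels `|w| ≤ ℓ` after `T` costs the ratio of `Ĝ`**:
  `Ĝ(ℓ) · P(G ∩ {w enters [-ℓ, ℓ] at a time in [T, σ⋆]}) ≤ ∫_G Ĝ(w_T) dP`, where
  `Ĝ(w) = Ĝ_{1-κ/8,κ}(w + i) = (1+w²)^{-(8-κ)/(2κ)}` (Rohde–Schramm's `Ĝ` at the critical exponent,
  `rsGhatSlope_critical`): `Ĝ(w)` is `A`-superharmonic (`A Ĝ = -(1-κ/8) f Ĝ ≤ 0` by (6.9)), so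
  `Ĝ(w_{t∧σ⋆})` is a supermartingale (Itô decomposition `exists_martingale_slopeFunctional` with
  `E ≡ 1`) and optional stopping between `T` and the hitting time (`setIntegral_stoppedValue_sub_eq_zero`,
  `isStoppingTime_hittingFrom`) gives the bound — the scale-function estimate
  `P_w(reach ℓ) ≍ (ℓ/w)^{8/κ-1}` of the transient slope diffusion;
* `measureReal_inter_occupation_le` — **exponential tail of the occupation of high levels after
  `T`**: with `g_ℓ`, `μ_ℓ = ℓ²/C_κ`, `V_ℓ = 1 + μ_ℓ U_ℓ ∈ [1, 2]`, `(A + μ_ℓ g_ℓ) V_ℓ ≤ 0`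
  (`SLESlopeOccupationFn.lean`), the process `V_ℓ(w_{t∧σ⋆}) exp(μ_ℓ ∫_{T∧t}^{σ⋆∧t} g_ℓ(w)/y²)` is a
  supermartingale, whence `e^{μ_ℓ c} P(G ∩ {∫_T^{σ⋆} g_ℓ(w_r) y_r⁻² dr ≥ c}) ≤ 2 P(G)`.

These are the two inputs of the multi-scale bound on "`ψ` grows by a factor `e^R` after `T`"
(`SLEOnePointUpperEstimate.lean`; Beffara (2008), Prop. 4, upper half). Also: the pathwise identity
`∫₀ᵗ β e^{∫₀ β} = e^{∫₀ᵗ β} - 1` for `β = μ φ 𝟙_{(a,b]}`, `φ` continuous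
(`integral_indicator_mul_exp_eq`), which feeds the finite-variation factor `E = e^{∫ β}` of
`exists_martingale_slopeFunctional`.

## References

* V. Beffara, *The dimension of the SLE curves*, Ann. Probab. 36 (2008), Prop. 4.
* S. Rohde, O. Schramm, *Basic properties of SLE*, Ann. of Math. 161 (2005), Lemma 6.3, (6.9).
* D. Revuz, M. Yor, *Continuous Martingales and Brownian Motion* (1999), Ch. II, Thm (3.2);
  Ch. VII, §3.
-/

noncomputable section

open Set Filter MeasureTheory Complex intervalIntegral
open _root_.Topology
open scoped NNReal ENNReal

namespace Literature.Probability.RandomPlanarGeometry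

open Loewner Literature.Probability.Process Literature.Analysis.FunctionSpaces

/-! ### A pathwise identity: `∫₀ᵗ β e^{∫₀ β} = e^{∫₀ᵗ β} - 1` for `β = μ φ 𝟙_{(a, b]}` -/

section Pathwise

/-- For `φ` continuous, `0 ≤ a ≤ b`, `β = 𝟙_{(a,b]} μ φ` and `s` real:
`∫₀ˢ β = Ψ(clamp s)` with `Ψ(u) = ∫ₐᵘ μ φ`, `clamp s = max a (min s b)`. [folklore] -/
theorem integral_indicator_eq_clamp {φ : ℝ → ℝ} {a b : ℝ} (ha : 0 ≤ a) (μ : ℝ) (s : ℝ) :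
    ∫ r in (0 : ℝ)..s, (Ioc a b).indicator (fun r ↦ μ * φ r) r =
      ∫ r in a..(max a (min s b)), μ * φ r := by
  rcases le_or_gt 0 s with hs | hs
  · rw [integral_of_le hs, setIntegral_indicator measurableSet_Ioc, Ioc_inter_Ioc, max_eq_right ha]
    rcases le_or_gt a (min s b) with h1 | h1
    · rw [max_eq_right h1, integral_of_le h1]
    · rw [max_eq_left h1.le, Ioc_eq_empty (not_lt.2 h1.le), Measure.restrict_empty,
        integral_zero_measure, integral_same]
  · have h1 : max a (min s b) = a := max_eq_left ((min_le_left _ _).trans (hs.le.trans ha))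
    rw [h1, integral_same, intervalIntegral.integral_symm s 0, integral_of_le hs.le]
    have h2 : ∫ r in Ioc s 0, (Ioc a b).indicator (fun r ↦ μ * φ r) r = ∫ r in Ioc s 0, (0 : ℝ) := by
      refine setIntegral_congr_fun measurableSet_Ioc fun r hr ↦ ?_
      exact indicator_of_notMem (fun h ↦ by linarith [h.1, hr.2]) _
    rw [h2]
    simp

/-- **`∫₀ᵗ β(s) exp(∫₀ˢ β) ds = exp(∫₀ᵗ β) - 1`** for `β = 𝟙_{(a,b]} μ φ` with `φ` continuous,
`0 ≤ a ≤ b`, `t ≥ 0` (the integrated form of `(e^{Φ})' = Φ' e^{Φ}` for the piecewise-`C¹`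
primitive `Φ = ∫₀ β`: on `(a, b]` it is the fundamental theorem of calculus for
`exp ∘ Ψ`, `Ψ = ∫ₐ μφ`, and `β` vanishes elsewhere). [folklore] -/
theorem integral_indicator_mul_exp_eq {φ : ℝ → ℝ} (hφ : Continuous φ) {a b : ℝ} (ha : 0 ≤ a)
    (μ : ℝ) {t : ℝ} (ht : 0 ≤ t) :
    ∫ s in (0 : ℝ)..t, (Ioc a b).indicator (fun r ↦ μ * φ r) s *
        Real.exp (∫ r in (0 : ℝ)..s, (Ioc a b).indicator (fun r ↦ μ * φ r) r) =
      Real.exp (∫ r in (0 : ℝ)..t, (Ioc a b).indicator (fun r ↦ μ * φ r) r) - 1 := by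
  set Ψ : ℝ → ℝ := fun u ↦ ∫ r in a..u, μ * φ r with hΨ
  have hcont : Continuous fun r ↦ μ * φ r := continuous_const.mul hφ
  have hΨd : ∀ u, HasDerivAt Ψ (μ * φ u) u := fun u ↦ (hcont.integral_hasStrictDerivAt a u).hasDerivAt
  have hclamp : ∀ s, (∫ r in (0 : ℝ)..s, (Ioc a b).indicator (fun r ↦ μ * φ r) r) =
      Ψ (max a (min s b)) := fun s ↦ integral_indicator_eq_clamp ha μ s
  -- the integrand is `𝟙_{(a,b]}(s) μ φ(s) exp(Ψ s)`
  have hint : ∀ s, (Ioc a b).indicator (fun r ↦ μ * φ r) s * Real.exp (Ψ (max a (min s b))) =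
      (Ioc a b).indicator (fun r ↦ μ * φ r * Real.exp (Ψ r)) s := by
    intro s
    by_cases hs : s ∈ Ioc a b
    · rw [indicator_of_mem hs, indicator_of_mem hs, min_eq_left hs.2, max_eq_right hs.1.le]
    · rw [indicator_of_notMem hs, indicator_of_notMem hs, zero_mul]
  have hcongr : (∫ s in (0 : ℝ)..t, (Ioc a b).indicator (fun r ↦ μ * φ r) s *
        Real.exp (∫ r in (0 : ℝ)..s, (Ioc a b).indicator (fun r ↦ μ * φ r) r)) =
      ∫ s in (0 : ℝ)..t, (Ioc a b).indicator (fun r ↦ μ * φ r * Real.exp (Ψ r)) s := by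
    refine integral_congr fun s _ ↦ ?_
    show _ = (Ioc a b).indicator (fun r ↦ μ * φ r * Real.exp (Ψ r)) s
    rw [← hint s, hclamp s]
  rw [hcongr, hclamp t, integral_of_le ht, setIntegral_indicator measurableSet_Ioc, Ioc_inter_Ioc,
    max_eq_right ha]
  have hFTC : ∀ {m : ℝ}, a ≤ m → ∫ s in a..m, μ * φ s * Real.exp (Ψ s) =
      Real.exp (Ψ m) - Real.exp (Ψ a) := by
    intro m hm
    refine integral_eq_sub_of_hasDerivAt (f := fun u ↦ Real.exp (Ψ u))
      (f' := fun s ↦ μ * φ s * Real.exp (Ψ s)) (fun s _ ↦ ?_) ?_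
    · have h1 := (hΨd s).exp
      have h2 : Real.exp (Ψ s) * (μ * φ s) = μ * φ s * Real.exp (Ψ s) := by ring
      rw [h2] at h1
      exact h1
    · exact ((hcont.mul (Real.continuous_exp.comp (continuous_iff_continuousAt.2 fun u ↦
        (hΨd u).continuousAt))).intervalIntegrable _ _)
  have hΨa : Ψ a = 0 := by simp [hΨ]
  rcases le_or_gt a (min t b) with h1 | h1
  · rw [max_eq_right h1, ← integral_of_le h1, hFTC h1, hΨa, Real.exp_zero]
  · rw [max_eq_left h1.le, Ioc_eq_empty (not_lt.2 h1.le), Measure.restrict_empty,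
      integral_zero_measure, hΨa, Real.exp_zero, sub_self]

end Pathwise

/-! ### The setting: the flow stopped at `σ⋆ = T_S ∧ ρₙ` -/

section Setting

variable (κ : ℝ≥0) (z : ℂ) (S : ℝ) (n : ℕ)

/-- `σ⋆ = T_S ∧ ρₙ` (the tree's `sleCotArgLocTime`): the clock of all estimates of this file.
[folklore] -/
abbrev sleStarTime : (ℝ≥0 → ℝ) → WithTop ℝ≥0 := sleCotArgLocTime κ z S n

/-- The slope stopped at `σ⋆`. [folklore] -/
abbrev sleStarSlope : ℝ≥0 → (ℝ≥0 → ℝ) → ℝ := sleStopSlope κ z (sleStarTime κ z S n)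

/-- The imaginary part stopped at `σ⋆`. [folklore] -/
abbrev sleStarIm : ℝ≥0 → (ℝ≥0 → ℝ) → ℝ := stoppedProcess (slePointIm κ z) (sleStarTime κ z S n)

/-- **The occupation rate `φ_ℓ(r) = g_ℓ(w_r) y_r⁻²`** along the flow stopped at `σ⋆` (continuous
paths, progressive, `0 ≤ φ ≤ 4 ((n+2)/Im z)²`). [folklore] -/
def sleOccRate (ℓ : ℝ) (r : ℝ≥0) (ω : ℝ≥0 → ℝ) : ℝ :=
  bandRate ℓ (sleStarSlope κ z S n r ω) * (sleStarIm κ z S n r ω)⁻¹ ^ 2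

/-- **The occupation of the levels `≳ ℓ` after `T`**: `∫_T^{σ⋆} g_ℓ(w_r) y_r⁻² dr`, written as the
time integral over `[0, n+1] ⊇ [0, σ⋆]` of `𝟙_{r ≤ σ⋆} φ - 𝟙_{r ≤ T} φ`. [folklore] -/
def sleOccAfter (ℓ : ℝ) (T : (ℝ≥0 → ℝ) → WithTop ℝ≥0) (ω : ℝ≥0 → ℝ) : ℝ :=
  ∫ r in (0 : ℝ)..((n : ℝ) + 1), (trunc (sleStarTime κ z S n) (sleOccRate κ z S n ℓ) r.toNNReal ω -
    trunc T (sleOccRate κ z S n ℓ) r.toNNReal ω)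

variable {κ z S n}

/-- `σ⋆` is a stopping time. [folklore] -/
theorem isStoppingTime_sleStarTime (hz : 0 < z.im) :
    IsStoppingTime brownianFiltration (sleStarTime κ z S n) :=
  isStoppingTime_sleCotArgLocTime hz S n

/-- `σ⋆ ≤ ρₙ`. [folklore] -/
theorem sleStarTime_le_locTime (ω : ℝ≥0 → ℝ) : sleStarTime κ z S n ω ≤ slePointLocTime κ z n ω :=
  sleCotArgLocTime_le_locTime S n ω

/-- `σ⋆ ≤ n + 1`. [folklore] -/
theorem sleStarTime_le_succ (ω : ℝ≥0 → ℝ) :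
    sleStarTime κ z S n ω ≤ (((n : ℝ≥0) + 1 : ℝ≥0) : WithTop ℝ≥0) :=
  (sleStarTime_le_locTime ω).trans (slePointLocTime_le n ω)

/-- `σ⋆ < ⊤`. [folklore] -/
theorem sleStarTime_ne_top (ω : ℝ≥0 → ℝ) : sleStarTime κ z S n ω ≠ ⊤ :=
  ne_top_of_le_ne_top WithTop.coe_ne_top (sleStarTime_le_succ ω)

/-- `|w| ≤ S` on `[0, σ⋆]` when `|w₀| < S`. [folklore] -/
theorem abs_cotArg_le_of_le_sleStarTime (hz : 0 < z.im) (h0 : |z.re / z.im| < S) (ω : ℝ≥0 → ℝ)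
    (t : ℝ≥0) (ht : (t : WithTop ℝ≥0) ≤ sleStarTime κ z S n ω) :
    |cotArg (sleDriving κ ω) z t| ≤ S :=
  abs_cotArg_le_of_le_sleCotArgLocTime hz h0 ht

/-- `y > 0` along the stopped flow. [folklore] -/
theorem sleStarIm_pos (hz : 0 < z.im) (r : ℝ≥0) (ω : ℝ≥0 → ℝ) : 0 < sleStarIm κ z S n r ω :=
  stoppedProcess_slePointIm_pos hz sleStarTime_le_locTime r ω

/-- `y ≥ Im z/(n+2)` along the stopped flow. [folklore] -/
theorem level_le_sleStarIm (hz : 0 < z.im) (r : ℝ≥0) (ω : ℝ≥0 → ℝ) :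
    z.im / (n + 2) ≤ sleStarIm κ z S n r ω :=
  level_le_stoppedProcess_slePointIm hz sleStarTime_le_locTime r ω

/-- `0 ≤ φ`. [folklore] -/
theorem sleOccRate_nonneg (ℓ : ℝ) (r : ℝ≥0) (ω : ℝ≥0 → ℝ) : 0 ≤ sleOccRate κ z S n ℓ r ω :=
  mul_nonneg (bandRate_nonneg _ _) (sq_nonneg _)

/-- `φ ≤ 4 ((n+2)/Im z)²`. [folklore] -/
theorem sleOccRate_le (hz : 0 < z.im) (ℓ : ℝ) (r : ℝ≥0) (ω : ℝ≥0 → ℝ) :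
    sleOccRate κ z S n ℓ r ω ≤ 4 * ((n + 2) / z.im) ^ 2 := by
  have hy := sleStarIm_pos (κ := κ) (S := S) (n := n) hz r ω
  have hlev := level_le_sleStarIm (κ := κ) (S := S) (n := n) hz r ω
  have hinv : (sleStarIm κ z S n r ω)⁻¹ ≤ (n + 2) / z.im := by
    rw [inv_eq_one_div, div_le_div_iff₀ hy hz, one_mul]
    rw [div_le_iff₀ (by positivity : (0 : ℝ) < n + 2)] at hlev
    linarith
  unfold sleOccRate
  exact mul_le_mul (bandRate_le_four _ _) (pow_le_pow_left₀ (inv_pos.2 hy).le hinv 2)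
    (sq_nonneg _) (by norm_num)

/-- `|φ| ≤ 4 ((n+2)/Im z)²`. [folklore] -/
theorem abs_sleOccRate_le (hz : 0 < z.im) (ℓ : ℝ) (r : ℝ≥0) (ω : ℝ≥0 → ℝ) :
    |sleOccRate κ z S n ℓ r ω| ≤ 4 * ((n + 2) / z.im) ^ 2 := by
  rw [abs_of_nonneg (sleOccRate_nonneg ℓ r ω)]
  exact sleOccRate_le hz ℓ r ω

/-- `φ` has continuous paths. [folklore] -/
theorem continuous_sleOccRate (hz : 0 < z.im) (ℓ : ℝ) (ω : ℝ≥0 → ℝ) :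
    Continuous fun r ↦ sleOccRate κ z S n ℓ r ω :=
  ((continuous_bandRate ℓ).comp (continuous_sleStopSlope hz sleStarTime_le_locTime ω)).mul
    (((continuous_stoppedProcess_slePointIm hz _ ω).inv₀ fun r ↦ (sleStarIm_pos hz r ω).ne').pow 2)

/-- `φ` is progressive. [folklore] -/
theorem isStronglyProgressive_sleOccRate (hz : 0 < z.im) (ℓ : ℝ) :
    IsStronglyProgressive brownianFiltration (sleOccRate κ z S n ℓ) := by
  have h1 := IsStronglyProgressive.continuous_comp (isStronglyProgressive_sleStopSlope hz
    (isStoppingTime_sleStarTime hz) (sleStarTime_le_locTime (κ := κ) (z := z) (S := S) (n := n)))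
    (continuous_bandRate ℓ)
  have h2 : IsStronglyProgressive brownianFiltration (fun r ω ↦ (sleStarIm κ z S n r ω)⁻¹) :=
    StronglyAdapted.isStronglyProgressive_of_continuous
      (fun t ↦ (stronglyAdapted_stoppedProcess_slePointIm hz (isStoppingTime_sleStarTime hz)
        t).measurable.inv.stronglyMeasurable)
      fun ω ↦ (continuous_stoppedProcess_slePointIm hz _ ω).inv₀ fun r ↦ (sleStarIm_pos hz r ω).ne'
  have heq : sleOccRate κ z S n ℓ = fun r ω ↦ bandRate ℓ (sleStarSlope κ z S n r ω) *
      ((sleStarIm κ z S n r ω)⁻¹ * (sleStarIm κ z S n r ω)⁻¹) := by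
    funext r ω; rw [sleOccRate, sq]
  rw [heq]
  exact h1.mul (h2.mul h2)

end Setting

/-! ### Stopped values: measurability helpers -/

section StoppedValues

variable {Ω : Type*} {m : MeasurableSpace Ω} {𝓕 : Filtration ℝ≥0 m} {u : ℝ≥0 → Ω → ℝ}
  {τ : Ω → WithTop ℝ≥0}

/-- The value of a progressive real process at a stopping time is measurable. [folklore] -/
theorem measurable_stoppedValue' (hu : IsStronglyProgressive 𝓕 u) (hτ : IsStoppingTime 𝓕 τ) :
    Measurable fun ω ↦ u (τ ω).untopA ω :=
  (measurable_stoppedValue hu hτ).mono hτ.measurableSpace_le le_rfl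

/-- `{u_τ ∈ B} ∈ 𝓕_τ` for a progressive real process, a stopping time and a Borel `B`. [folklore] -/
theorem measurableSet_stoppedValue_mem (hu : IsStronglyProgressive 𝓕 u) (hτ : IsStoppingTime 𝓕 τ)
    {B : Set ℝ} (hB : MeasurableSet B) :
    MeasurableSet[hτ.measurableSpace] {ω | u (τ ω).untopA ω ∈ B} :=
  measurable_stoppedValue hu hτ hB

end StoppedValues

/-! ### The critical `Ĝ` as an `A`-superharmonic function -/

section Ghat

variable {κ : ℝ≥0}

/-- `Ĝ(w) = Ĝ_{1-κ/8,κ}(w + i)`, abbreviation. [folklore] -/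
abbrev ghatC (κ : ℝ≥0) : ℝ → ℝ := rsGhatSlope (1 - (κ : ℝ) / 8) κ

/-- **`A Ĝ = -(1-κ/8) f Ĝ`** by (6.9) at the critical exponent. [cite: RohdeSchramm2005, Lemma 6.3 (proof)] -/
theorem slopeGen_ghatC (hκ : 0 < κ) (w : ℝ) :
    slopeGen κ (ghatC κ) w = -(1 - (κ : ℝ) / 8) * slopeRate w * ghatC κ w := by
  have hκ0 : (0 : ℝ) < κ := by exact_mod_cast hκ
  have hdisc : 0 ≤ 32 * (1 - (κ : ℝ) / 8) * κ + (2 * (κ : ℝ) - 8) ^ 2 := by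
    rw [discr_oneSub]; norm_num
  have h0 := rsGhatSlope_ode' hκ0 hdisc w
  rw [slopeGen_apply, slopeRate_apply]
  have : (κ : ℝ) / 2 * iteratedDeriv 2 (rsGhatSlope (1 - (κ : ℝ) / 8) κ) w +
      4 * w / (1 + w ^ 2) * deriv (rsGhatSlope (1 - (κ : ℝ) / 8) κ) w =
      -(4 * (1 - (κ : ℝ) / 8) / (1 + w ^ 2) ^ 2 * rsGhatSlope (1 - (κ : ℝ) / 8) κ w) := by linarith
  rw [show ghatC κ = rsGhatSlope (1 - (κ : ℝ) / 8) κ from rfl, this]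
  ring

/-- `A Ĝ ≤ 0` (`0 < κ ≤ 8`). [folklore] -/
theorem slopeGen_ghatC_nonpos (hκ : 0 < κ) (hκ8 : κ ≤ 8) (w : ℝ) : slopeGen κ (ghatC κ) w ≤ 0 := by
  rw [slopeGen_ghatC hκ]
  have hκ8' : (κ : ℝ) ≤ 8 := by exact_mod_cast hκ8
  have ha : 0 ≤ 1 - (κ : ℝ) / 8 := by linarith
  have hG := (rsGhatSlope_critical_mem_Ioc (by exact_mod_cast hκ) hκ8' w).1.le
  have := mul_nonneg (mul_nonneg ha (slopeRate_nonneg w)) hG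
  linarith

/-- `0 < Ĝ ≤ 1`. [folklore] -/
theorem ghatC_mem_Ioc (hκ : 0 < κ) (hκ8 : κ ≤ 8) (w : ℝ) : ghatC κ w ∈ Ioc (0 : ℝ) 1 :=
  rsGhatSlope_critical_mem_Ioc (by exact_mod_cast hκ) (by exact_mod_cast hκ8) w

/-- `Ĝ` is non-increasing in `|w|`: `|v| ≤ ℓ → Ĝ(ℓ) ≤ Ĝ(v)`. [folklore] -/
theorem ghatC_le_of_abs_le (hκ : 0 < κ) (hκ8 : κ ≤ 8) {v ℓ : ℝ} (h : |v| ≤ ℓ) : ghatC κ ℓ ≤ ghatC κ v :=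
  rsGhatSlope_critical_le_of_abs_le (by exact_mod_cast hκ) (by exact_mod_cast hκ8) h

/-- `Ĝ ∈ C²`. [folklore] -/
theorem contDiff_ghatC : ContDiff ℝ 2 (ghatC κ) := contDiff_rsGhatSlope _ _

end Ghat

/-! ### `untopA` helpers and the drift of `F(w) E` -/

section Helpers

/-- `↑(x.untopA) = x` for `x ≠ ⊤`. [folklore] -/
theorem coe_untopA_of_ne_top {x : WithTop ℝ≥0} (hx : x ≠ ⊤) : ((x.untopA : ℝ≥0) : WithTop ℝ≥0) = x := by
  rw [WithTop.untopA_eq_untop hx, WithTop.coe_untop]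

/-- `x ≤ y`, both finite, gives `x.untopA ≤ y.untopA` (as reals). [folklore] -/
theorem untopA_le_untopA_of_le {x y : WithTop ℝ≥0} (hxy : x ≤ y) (hy : y ≠ ⊤) :
    ((x.untopA : ℝ≥0) : ℝ) ≤ (y.untopA : ℝ≥0) := by
  have hx : x ≠ ⊤ := ne_top_of_le_ne_top hy hxy
  rw [← coe_untopA_of_ne_top hx, ← coe_untopA_of_ne_top hy, WithTop.coe_le_coe] at hxy
  exact_mod_cast hxy

variable {κ : ℝ≥0} {z : ℂ} {n : ℕ} {σ : (ℝ≥0 → ℝ) → WithTop ℝ≥0}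

/-- **The drift of `F(w) E` is bounded and progressive, hence its paths are integrable on compact
time intervals** (setting of `exists_martingale_slopeFunctional`). [folklore] -/
theorem intervalIntegrable_slopeFunctionalDrift (hz : 0 < z.im)
    (hσ : IsStoppingTime brownianFiltration σ) (hσρ : ∀ ω, σ ω ≤ slePointLocTime κ z n ω)
    {S : ℝ} (hS : ∀ (ω : ℝ≥0 → ℝ) (t : ℝ≥0), (t : WithTop ℝ≥0) ≤ σ ω →
      |cotArg (sleDriving κ ω) z t| ≤ S)
    {F : ℝ → ℝ} (hF : ContDiff ℝ 2 F) {E β : ℝ≥0 → (ℝ≥0 → ℝ) → ℝ}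
    (hEa : StronglyAdapted brownianFiltration E) (hEc : ∀ ω, Continuous (E · ω))
    (hβ : IsStronglyProgressive brownianFiltration β) {Cβ : ℝ} (hCβ : ∀ t ω, |β t ω| ≤ Cβ)
    {CE : ℝ} (hCE : ∀ t ω, |E t ω| ≤ CE) (ω : ℝ≥0 → ℝ) (a b : ℝ≥0) :
    IntervalIntegrable (fun s : ℝ ↦ slopeFunctionalDrift κ z σ F E β s.toNNReal ω) volume a b := by
  have hσ' : ∀ t : ℝ≥0, MeasurableSet[brownianFiltration t] {ω | σ ω < t} :=
    fun t ↦ hσ.measurableSet_lt t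
  set w := sleStopSlope κ z σ with hw
  set Y := stoppedProcess (slePointIm κ z) σ with hY
  have hwS : ∀ t ω, |w t ω| ≤ S := abs_sleStopSlope_le hz hσρ hS
  have hS0 : 0 ≤ S := (abs_nonneg _).trans (hwS 0 fun _ ↦ 0)
  have hwmem : ∀ t ω, w t ω ∈ Icc (-S) S := fun t ω ↦ abs_le.1 (hwS t ω)
  have hc0 : Continuous F := hF.continuous
  have hc1 : Continuous (deriv F) := hF.continuous_deriv (by norm_num)
  have hc2 : Continuous (iteratedDeriv 2 F) := hF.continuous_iteratedDeriv 2 le_rfl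
  have hgen : Continuous (slopeGen κ F) := by
    unfold slopeGen
    refine (continuous_const.mul hc2).add ((Continuous.div ?_ ?_ fun w ↦ ?_).mul hc1)
    · exact continuous_const.mul continuous_id
    · exact continuous_const.add (continuous_id.pow 2)
    · positivity
  obtain ⟨C0, hC0⟩ : ∃ C, ∀ v ∈ Icc (-S) S, |F v| ≤ C := by
    obtain ⟨C, hC⟩ := isCompact_Icc.exists_bound_of_continuousOn hc0.continuousOn
    exact ⟨C, fun v hv ↦ by simpa [Real.norm_eq_abs] using hC v hv⟩
  obtain ⟨C2, hC2⟩ : ∃ C, ∀ v ∈ Icc (-S) S, |slopeGen κ F v| ≤ C := by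
    obtain ⟨C, hC⟩ := isCompact_Icc.exists_bound_of_continuousOn hgen.continuousOn
    exact ⟨C, fun v hv ↦ by simpa [Real.norm_eq_abs] using hC v hv⟩
  have hC00 : 0 ≤ C0 := (abs_nonneg _).trans (hC0 _ (hwmem 0 ω))
  have hC20 : 0 ≤ C2 := (abs_nonneg _).trans (hC2 _ (hwmem 0 ω))
  have hCE0 : 0 ≤ CE := (abs_nonneg _).trans (hCE 0 ω)
  have hYpos : ∀ t ω, 0 < Y t ω := fun t ω ↦ stoppedProcess_slePointIm_pos hz hσρ t ω
  have hYlev : ∀ t ω, z.im / (n + 2) ≤ Y t ω := fun t ω ↦ level_le_stoppedProcess_slePointIm hz hσρ t ω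
  have hAbd : ∀ t ω, |(Y t ω)⁻¹| ≤ (n + 2) / z.im := fun t ω ↦ by
    rw [abs_of_pos (inv_pos.2 (hYpos t ω)), inv_eq_one_div, div_le_div_iff₀ (hYpos t ω) hz, one_mul]
    have := hYlev t ω
    rw [div_le_iff₀ (by positivity : (0 : ℝ) < n + 2)] at this
    linarith
  -- progressivity
  have hwp : IsStronglyProgressive brownianFiltration w := isStronglyProgressive_sleStopSlope hz hσ hσρ
  have hAp : IsStronglyProgressive brownianFiltration (fun t ω ↦ (Y t ω)⁻¹) :=
    StronglyAdapted.isStronglyProgressive_of_continuous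
      (fun t ↦ (stronglyAdapted_stoppedProcess_slePointIm hz hσ t).measurable.inv.stronglyMeasurable)
      fun ω ↦ (continuous_stoppedProcess_slePointIm hz σ ω).inv₀ fun t ↦ (hYpos t ω).ne'
  have hEp : IsStronglyProgressive brownianFiltration E := hEa.isStronglyProgressive_of_continuous hEc
  have hDp : IsStronglyProgressive brownianFiltration (slopeFunctionalDrift κ z σ F E β) := by
    have h1 : IsStronglyProgressive brownianFiltration
        (trunc σ fun s ω ↦ (Y s ω)⁻¹ ^ 2 * slopeGen κ F (w s ω)) := by
      have heq : (fun s ω ↦ (Y s ω)⁻¹ ^ 2 * slopeGen κ F (w s ω)) =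
          fun s ω ↦ (Y s ω)⁻¹ * (Y s ω)⁻¹ * slopeGen κ F (w s ω) := by
        funext s ω; rw [sq]
      rw [heq]
      exact isStronglyProgressive_trunc ((hAp.mul hAp).mul
        (IsStronglyProgressive.continuous_comp hwp hgen)) hσ'
    exact (h1.mul hEp).add ((IsStronglyProgressive.continuous_comp hwp hc0).mul (hβ.mul hEp))
  -- bound
  have hDbd : ∀ t ω, |slopeFunctionalDrift κ z σ F E β t ω| ≤
      ((n + 2) / z.im) ^ 2 * C2 * CE + C0 * (Cβ * CE) := by
    intro t ω
    rw [slopeFunctionalDrift_apply]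
    refine (abs_add_le _ _).trans (add_le_add ?_ ?_)
    · rw [abs_mul]
      refine mul_le_mul ?_ (hCE t ω) (abs_nonneg _) (by positivity)
      rw [trunc_apply]
      split_ifs
      · rw [abs_mul, abs_pow]
        exact mul_le_mul (pow_le_pow_left₀ (abs_nonneg _) (hAbd t ω) 2) (hC2 _ (hwmem t ω))
          (abs_nonneg _) (by positivity)
      · rw [abs_zero]; positivity
    · rw [abs_mul, abs_mul]
      exact mul_le_mul (hC0 _ (hwmem t ω)) (mul_le_mul (hCβ t ω) (hCE t ω) (abs_nonneg _)
        ((abs_nonneg _).trans (hCβ t ω))) (by positivity) hC00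
  have hint : ∀ t : ℝ≥0, IntegrableOn (fun s : ℝ ↦ slopeFunctionalDrift κ z σ F E β s.toNNReal ω)
      (Icc 0 t) := fun t ↦ integrableOn_Icc_of_abs_le hDp hDbd ω t
  have hsub : uIcc (a : ℝ) b ⊆ Icc 0 (max a b : ℝ≥0) := by
    intro s hs
    rw [uIcc_comm, uIcc_comm] at hs
    rcases le_total (a : ℝ) b with hab | hab
    · rw [uIcc_of_le hab] at hs
      exact ⟨a.coe_nonneg.trans hs.1, hs.2.trans (by exact_mod_cast le_max_right a b)⟩
    · rw [uIcc_of_ge hab] at hs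
      exact ⟨b.coe_nonneg.trans hs.1, hs.2.trans (by exact_mod_cast le_max_left a b)⟩
  exact (MeasureTheory.IntegrableOn.mono_set (hint (max a b)) hsub).intervalIntegrable

end Helpers

/-! ### Reaching the levels `|w| ≤ ℓ` after `T` -/

section Hit

variable {κ : ℝ≥0} {z : ℂ} {S : ℝ} {n : ℕ}

/-- The stopped slope read at a time only depends on the time through `· ∧ σ⋆`: if `H ≠ ⊤` then
`w_{(H ∧ σ⋆)} = w_H`. [folklore] -/
theorem sleStarSlope_min_eq {H : WithTop ℝ≥0} (hH : H ≠ ⊤) (ω : ℝ≥0 → ℝ) :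
    sleStarSlope κ z S n (min H (sleStarTime κ z S n ω)).untopA ω =
      sleStarSlope κ z S n H.untopA ω := by
  have hσ : sleStarTime κ z S n ω ≠ ⊤ := sleStarTime_ne_top ω
  have hmin : min H (sleStarTime κ z S n ω) ≠ ⊤ := by simp [hH, hσ]
  have key : min (((min H (sleStarTime κ z S n ω)).untopA : ℝ≥0) : WithTop ℝ≥0) (sleStarTime κ z S n ω) =
      min ((H.untopA : ℝ≥0) : WithTop ℝ≥0) (sleStarTime κ z S n ω) := by
    rw [coe_untopA_of_ne_top hmin, coe_untopA_of_ne_top hH, min_assoc, min_self]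
  show stoppedProcess (slePointRe κ z) _ _ ω * (stoppedProcess (slePointIm κ z) _ _ ω)⁻¹ =
    stoppedProcess (slePointRe κ z) _ _ ω * (stoppedProcess (slePointIm κ z) _ _ ω)⁻¹
  simp only [stoppedProcess, key]

/-- **Reaching `|w| ≤ ℓ` after `T` costs `Ĝ(w_T)/Ĝ(ℓ)`.** Let `0 < κ < 8`, `z ∈ ℍ`, `|w₀| < S`,
`T ≤ σ⋆` a stopping time, `G ∈ 𝓕_T`, `ℓ` real, and `H = hittingFrom w [-ℓ, ℓ] T` the first time
`≥ T` at which the `σ⋆`-stopped slope is in `[-ℓ, ℓ]`. Then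
`Ĝ(ℓ) · P(G ∩ {H ≠ ⊤}) ≤ ∫_G Ĝ(w_T) dP`.
Proof: `Ĝ(w_{t∧σ⋆})` is a bounded supermartingale (`exists_martingale_slopeFunctional` with
`F = Ĝ`, `E ≡ 1`, drift `𝟙 y⁻² (AĜ)(w) ≤ 0`); optional stopping between `T` and `H ∧ σ⋆`
(`setIntegral_stoppedValue_sub_eq_zero`) gives `∫_G Ĝ(w_{H∧σ⋆}) ≤ ∫_G Ĝ(w_T)`, and on `{H ≠ ⊤}`,
`|w_H| ≤ ℓ` so `Ĝ(w_H) ≥ Ĝ(ℓ)`. This is the scale-function bound `P_w(reach level ℓ) ≲ (ℓ/|w|)^{8/κ-1}`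
for the transient slope diffusion. [folklore] -/
theorem measureReal_inter_hit_le (hκ : 0 < κ) (hκ8 : κ < 8) (hz : 0 < z.im) (h0 : |z.re / z.im| < S)
    {T : (ℝ≥0 → ℝ) → WithTop ℝ≥0} (hT : IsStoppingTime brownianFiltration T)
    (hTσ : ∀ ω, T ω ≤ sleStarTime κ z S n ω) {G : Set (ℝ≥0 → ℝ)}
    (hG : MeasurableSet[hT.measurableSpace] G) (ℓ : ℝ) :
    ghatC κ ℓ * preWienerMeasure.real
        (G ∩ {ω | hittingFrom (sleStarSlope κ z S n) (Icc (-ℓ) ℓ) T ω ≠ ⊤}) ≤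
      ∫ ω in G, ghatC κ (sleStarSlope κ z S n (T ω).untopA ω) ∂preWienerMeasure := by
  haveI := isProbabilityMeasure_preWienerMeasure'
  set P := preWienerMeasure with hP
  set σs := sleStarTime κ z S n with hσs
  set w := sleStarSlope κ z S n with hw
  set H := hittingFrom w (Icc (-ℓ) ℓ) T with hH
  have hκ8le : κ ≤ 8 := hκ8.le
  have hσ := isStoppingTime_sleStarTime (κ := κ) (S := S) (n := n) hz
  have hσρ : ∀ ω, σs ω ≤ slePointLocTime κ z n ω := sleStarTime_le_locTime
  have hSb : ∀ (ω : ℝ≥0 → ℝ) (t : ℝ≥0), (t : WithTop ℝ≥0) ≤ σs ω → |cotArg (sleDriving κ ω) z t| ≤ S :=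
    abs_cotArg_le_of_le_sleStarTime hz h0
  have hwc : ∀ ω, Continuous fun t ↦ w t ω := continuous_sleStopSlope hz hσρ
  have hwa : StronglyAdapted brownianFiltration w := stronglyAdapted_sleStopSlope hz hσ
  have hwp : IsStronglyProgressive brownianFiltration w := isStronglyProgressive_sleStopSlope hz hσ hσρ
  have hGm : MeasurableSet G := hG.1
  -- the supermartingale `Ĝ(w)`: Itô decomposition with `E ≡ 1`, `β ≡ 0`
  have hEa1 : StronglyAdapted brownianFiltration (fun (_ : ℝ≥0) (_ : ℝ≥0 → ℝ) ↦ (1 : ℝ)) :=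
    fun _ ↦ stronglyMeasurable_const
  obtain ⟨K, hKM, hKc, hK0, hae⟩ := exists_martingale_slopeFunctional (κ := κ) (F := ghatC κ) hz hσ hσρ
    hSb contDiff_ghatC (E := fun _ _ ↦ (1 : ℝ)) (β := fun _ _ ↦ (0 : ℝ))
    hEa1 (fun _ ↦ continuous_const) (isStronglyProgressive_const _ _)
    (Cβ := 0) (fun _ _ ↦ by simp) (CE := 1) (fun _ _ ↦ by simp) (fun ω t ↦ by simp)
  have hDint : ∀ (ω : ℝ≥0 → ℝ) (a b : ℝ≥0), IntervalIntegrable (fun s : ℝ ↦ slopeFunctionalDrift κ z σs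
      (ghatC κ) (fun _ _ ↦ (1 : ℝ)) (fun _ _ ↦ (0 : ℝ)) s.toNNReal ω) volume a b := fun ω a b ↦
    intervalIntegrable_slopeFunctionalDrift (κ := κ) (F := ghatC κ) hz hσ hσρ hSb
      contDiff_ghatC (E := fun _ _ ↦ (1 : ℝ)) (β := fun _ _ ↦ (0 : ℝ)) hEa1 (fun _ ↦ continuous_const)
      (isStronglyProgressive_const _ _) (Cβ := 0) (fun _ _ ↦ by simp) (CE := 1) (fun _ _ ↦ by simp) ω a b
  -- the drift is non-positive
  have hD : ∀ s ω, slopeFunctionalDrift κ z σs (ghatC κ) (fun _ _ ↦ (1 : ℝ)) (fun _ _ ↦ (0 : ℝ)) s ω ≤ 0 := by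
    intro s ω
    rw [slopeFunctionalDrift_apply, trunc_apply]
    simp only [mul_zero, add_zero, mul_one]
    split_ifs
    · exact mul_nonpos_of_nonneg_of_nonpos (sq_nonneg _) (slopeGen_ghatC_nonpos hκ hκ8le _)
    · exact le_rfl
  -- the stopping times `T ≤ T₂ = H ∧ σ⋆ ≤ n + 1`
  have hHst : IsStoppingTime brownianFiltration H :=
    isStoppingTime_hittingFrom (fun t ↦ (hwa t).measurable) hwc isClosed_Icc hT
  set T₂ : (ℝ≥0 → ℝ) → WithTop ℝ≥0 := fun ω ↦ min (H ω) (σs ω) with hT₂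
  have hT₂st : IsStoppingTime brownianFiltration T₂ := hHst.min hσ
  have hTT₂ : ∀ ω, T ω ≤ T₂ ω := fun ω ↦ le_min le_hittingFrom (hTσ ω)
  have hT₂N : ∀ ω, T₂ ω ≤ (((n : ℝ≥0) + 1 : ℝ≥0) : WithTop ℝ≥0) := fun ω ↦
    (min_le_right _ _).trans (sleStarTime_le_succ ω)
  have hT₂ne : ∀ ω, T₂ ω ≠ ⊤ := fun ω ↦ ne_top_of_le_ne_top WithTop.coe_ne_top (hT₂N ω)
  have hTN : ∀ ω, T ω ≤ (((n : ℝ≥0) + 1 : ℝ≥0) : WithTop ℝ≥0) := fun ω ↦ (hTT₂ ω).trans (hT₂N ω)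
  -- optional stopping
  have hOS := setIntegral_stoppedValue_sub_eq_zero hKM hKc hK0 hT hT₂st hTT₂ hT₂N hG
  -- pathwise: `Ĝ(w_{T₂}) - Ĝ(w_T) ≤ K_{T₂} - K_T`
  have hpath : ∀ᵐ ω ∂P, ghatC κ (w (T₂ ω).untopA ω) - ghatC κ (w (T ω).untopA ω) ≤
      K (T₂ ω).untopA ω - K (T ω).untopA ω := by
    filter_upwards [hae] with ω hω
    have h2 := hω (T₂ ω).untopA
    have h1 := hω (T ω).untopA
    simp only [mul_one] at h1 h2
    have hle : (((T ω).untopA : ℝ≥0) : ℝ) ≤ (T₂ ω).untopA := untopA_le_untopA_of_le (hTT₂ ω) (hT₂ne ω)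
    have hsplit := integral_add_adjacent_intervals (hDint ω 0 (T ω).untopA)
      (hDint ω (T ω).untopA (T₂ ω).untopA)
    have hneg : (∫ s in (((T ω).untopA : ℝ≥0) : ℝ)..(T₂ ω).untopA, slopeFunctionalDrift κ z σs (ghatC κ)
        (fun _ _ ↦ (1 : ℝ)) (fun _ _ ↦ (0 : ℝ)) s.toNNReal ω) ≤ 0 := by
      have := intervalIntegral.integral_nonneg (μ := volume) hle (f := fun s ↦ -slopeFunctionalDrift κ z σs
        (ghatC κ) (fun _ _ ↦ (1 : ℝ)) (fun _ _ ↦ (0 : ℝ)) s.toNNReal ω) fun s _ ↦ neg_nonneg.2 (hD _ ω)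
      rw [intervalIntegral.integral_neg] at this
      linarith
    rw [NNReal.coe_zero] at hsplit
    linarith
  -- integrability of the four stopped values
  have hGc : Continuous (ghatC κ) := contDiff_ghatC.continuous
  have hZm : ∀ {τ : (ℝ≥0 → ℝ) → WithTop ℝ≥0}, IsStoppingTime brownianFiltration τ →
      Measurable fun ω ↦ ghatC κ (w (τ ω).untopA ω) := fun hτ ↦
    hGc.measurable.comp (measurable_stoppedValue' hwp hτ)
  have hZbd : ∀ (τ : (ℝ≥0 → ℝ) → WithTop ℝ≥0) ω, ‖ghatC κ (w (τ ω).untopA ω)‖ ≤ 1 := fun τ ω ↦ by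
    rw [Real.norm_eq_abs, abs_of_pos (ghatC_mem_Ioc hκ hκ8le _).1]
    exact (ghatC_mem_Ioc hκ hκ8le _).2
  have hZint : ∀ {τ : (ℝ≥0 → ℝ) → WithTop ℝ≥0}, IsStoppingTime brownianFiltration τ →
      Integrable (fun ω ↦ ghatC κ (w (τ ω).untopA ω)) P := fun hτ ↦
    Integrable.of_bound (hZm hτ).aestronglyMeasurable 1 (ae_of_all _ (hZbd _))
  have hKint₁ := integrable_stoppedValue_of_martingale hKM hKc hT hTN
  have hKint₂ := integrable_stoppedValue_of_martingale hKM hKc hT₂st hT₂N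
  -- `∫_G Ĝ(w_{T₂}) ≤ ∫_G Ĝ(w_T)`
  have hstep : ∫ ω in G, ghatC κ (w (T₂ ω).untopA ω) ∂P ≤ ∫ ω in G, ghatC κ (w (T ω).untopA ω) ∂P := by
    have h1 : ∫ ω in G, (ghatC κ (w (T₂ ω).untopA ω) - ghatC κ (w (T ω).untopA ω)) ∂P ≤
        ∫ ω in G, (K (T₂ ω).untopA ω - K (T ω).untopA ω) ∂P :=
      setIntegral_mono_ae ((hZint hT₂st).sub (hZint hT)).integrableOn
        (hKint₂.sub hKint₁).integrableOn hpath
    rw [hOS, integral_sub (hZint hT₂st).integrableOn (hZint hT).integrableOn] at h1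
    linarith
  -- on `{H ≠ ⊤}`: `Ĝ(w_{T₂}) = Ĝ(w_H) ≥ Ĝ(ℓ)`
  have hHval : ∀ ω, H ω ≠ ⊤ → ghatC κ ℓ ≤ ghatC κ (w (T₂ ω).untopA ω) := by
    intro ω hH'
    have heq : w (T₂ ω).untopA ω = w (H ω).untopA ω := sleStarSlope_min_eq hH' ω
    rw [heq]
    obtain ⟨τ₀, hτ₀⟩ := WithTop.ne_top_iff_exists.1 hH'
    have hmem : w τ₀ ω ∈ Icc (-ℓ) ℓ := mem_of_hittingFrom_eq_coe isClosed_Icc (hwc ω) hτ₀.symm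
    have hτ₀' : (H ω).untopA = τ₀ := by rw [← hτ₀]; rfl
    rw [hτ₀']
    exact ghatC_le_of_abs_le hκ hκ8le (abs_le.2 hmem)
  have hHm : MeasurableSet {ω | H ω ≠ ⊤} := hHst.measurableSet_eq_top.compl
  -- assemble
  calc ghatC κ ℓ * P.real (G ∩ {ω | H ω ≠ ⊤})
      = ∫ ω in G ∩ {ω | H ω ≠ ⊤}, ghatC κ ℓ ∂P := by
        rw [setIntegral_const, smul_eq_mul, mul_comm]
    _ ≤ ∫ ω in G ∩ {ω | H ω ≠ ⊤}, ghatC κ (w (T₂ ω).untopA ω) ∂P :=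
        setIntegral_mono_on (integrable_const _).integrableOn (hZint hT₂st).integrableOn
          (hGm.inter hHm) fun ω hω ↦ hHval ω hω.2
    _ ≤ ∫ ω in G, ghatC κ (w (T₂ ω).untopA ω) ∂P :=
        setIntegral_mono_set (hZint hT₂st).integrableOn
          (ae_of_all _ fun ω ↦ (ghatC_mem_Ioc hκ hκ8le _).1.le)
          (ae_of_all _ inter_subset_left)
    _ ≤ ∫ ω in G, ghatC κ (w (T ω).untopA ω) ∂P := hstep

end Hit

/-! ### Occupation of the levels `≳ ℓ` after `T`: the exponential supermartingale -/

section Occ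

variable (κ : ℝ≥0) (z : ℂ) (S : ℝ) (n : ℕ)

/-- **The rate `β = μ (𝟙_{r ≤ σ⋆} φ - 𝟙_{r ≤ T} φ) = μ φ 𝟙_{T < r ≤ σ⋆}`** of the exponential
functional started at `T`. [folklore] -/
def sleOccBeta (ℓ μ : ℝ) (T : (ℝ≥0 → ℝ) → WithTop ℝ≥0) : ℝ≥0 → (ℝ≥0 → ℝ) → ℝ :=
  fun r ω ↦ μ * (trunc (sleStarTime κ z S n) (sleOccRate κ z S n ℓ) r ω -
    trunc T (sleOccRate κ z S n ℓ) r ω)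

/-- **The exponential functional `E_t = exp(∫₀ᵗ β) = exp(μ ∫_{T∧t}^{σ⋆∧t} g_ℓ(w) y⁻²)`.** [folklore] -/
def sleOccExp (ℓ μ : ℝ) (T : (ℝ≥0 → ℝ) → WithTop ℝ≥0) : ℝ≥0 → (ℝ≥0 → ℝ) → ℝ :=
  fun t ω ↦ Real.exp (∫ r in (0 : ℝ)..t, sleOccBeta κ z S n ℓ μ T r.toNNReal ω)

variable {κ z S n} {ℓ μ : ℝ} {T : (ℝ≥0 → ℝ) → WithTop ℝ≥0}

/-- Unfolding lemma for `sleOccBeta`. [folklore] -/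
theorem sleOccBeta_apply (r : ℝ≥0) (ω : ℝ≥0 → ℝ) :
    sleOccBeta κ z S n ℓ μ T r ω = μ * (trunc (sleStarTime κ z S n) (sleOccRate κ z S n ℓ) r ω -
      trunc T (sleOccRate κ z S n ℓ) r ω) := rfl

/-- Unfolding lemma for `sleOccExp`. [folklore] -/
theorem sleOccExp_apply (t : ℝ≥0) (ω : ℝ≥0 → ℝ) :
    sleOccExp κ z S n ℓ μ T t ω = Real.exp (∫ r in (0 : ℝ)..t, sleOccBeta κ z S n ℓ μ T r.toNNReal ω) := rfl

/-- `β` is progressive (`T` a stopping time). [folklore] -/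
theorem isStronglyProgressive_sleOccBeta (hz : 0 < z.im) (hT : IsStoppingTime brownianFiltration T) :
    IsStronglyProgressive brownianFiltration (sleOccBeta κ z S n ℓ μ T) := by
  have hφ := isStronglyProgressive_sleOccRate (κ := κ) (S := S) (n := n) hz ℓ
  have h1 := isStronglyProgressive_trunc hφ fun t ↦ (isStoppingTime_sleStarTime (κ := κ) (z := z)
    (S := S) (n := n) hz).measurableSet_lt t
  have h2 := isStronglyProgressive_trunc hφ fun t ↦ hT.measurableSet_lt t
  exact (isStronglyProgressive_const _ μ).mul (h1.sub h2)

/-- `0 ≤ β ≤ μ · 4((n+2)/Im z)²` for `μ ≥ 0` and `T ≤ σ⋆`. [folklore] -/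
theorem sleOccBeta_mem (hz : 0 < z.im) (hμ : 0 ≤ μ) (hTσ : ∀ ω, T ω ≤ sleStarTime κ z S n ω)
    (r : ℝ≥0) (ω : ℝ≥0 → ℝ) :
    sleOccBeta κ z S n ℓ μ T r ω ∈ Icc 0 (μ * (4 * ((n + 2) / z.im) ^ 2)) := by
  have hφ0 := sleOccRate_nonneg (κ := κ) (z := z) (S := S) (n := n) ℓ r ω
  have hφ1 := sleOccRate_le (κ := κ) (S := S) (n := n) hz ℓ r ω
  rw [sleOccBeta_apply, trunc_apply, trunc_apply]
  constructor
  · refine mul_nonneg hμ ?_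
    split_ifs with h1 h2 h2
    · simp
    · linarith
    · exact absurd (h2.trans (hTσ ω)) h1
    · simp
  · refine mul_le_mul_of_nonneg_left ?_ hμ
    split_ifs <;> linarith

/-- `|β| ≤ μ · 4((n+2)/Im z)²`. [folklore] -/
theorem abs_sleOccBeta_le (hz : 0 < z.im) (hμ : 0 ≤ μ) (hTσ : ∀ ω, T ω ≤ sleStarTime κ z S n ω)
    (r : ℝ≥0) (ω : ℝ≥0 → ℝ) :
    |sleOccBeta κ z S n ℓ μ T r ω| ≤ μ * (4 * ((n + 2) / z.im) ^ 2) := by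
  have h := sleOccBeta_mem (ℓ := ℓ) hz hμ hTσ r ω
  rw [abs_of_nonneg h.1]
  exact h.2

/-- **Pathwise, `β(r⁺) = 𝟙_{(T, σ⋆]}(r) μ φ(r⁺)` as a function of the real time `r`**
(`T ≤ σ⋆ < ⊤`). [folklore] -/
theorem sleOccBeta_toNNReal_eq (hTσ : ∀ ω, T ω ≤ sleStarTime κ z S n ω) (ω : ℝ≥0 → ℝ) (r : ℝ) :
    sleOccBeta κ z S n ℓ μ T r.toNNReal ω =
      (Ioc (((T ω).untopA : ℝ≥0) : ℝ) (((sleStarTime κ z S n ω).untopA : ℝ≥0) : ℝ)).indicator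
        (fun r ↦ μ * sleOccRate κ z S n ℓ r.toNNReal ω) r := by
  set σs := sleStarTime κ z S n ω with hσs
  have hσ' : σs ≠ ⊤ := sleStarTime_ne_top ω
  have hT' : T ω ≠ ⊤ := ne_top_of_le_ne_top hσ' (hTσ ω)
  rw [sleOccBeta_apply, trunc_apply, trunc_apply]
  rcases lt_or_ge r 0 with hr | hr
  · -- `r < 0`: both sides vanish
    have h0 : r.toNNReal = 0 := Real.toNNReal_of_nonpos hr.le
    rw [h0, if_pos (by simp), if_pos (by simp), sub_self, mul_zero, indicator_of_notMem]
    exact fun h ↦ by linarith [h.1, ((T ω).untopA : ℝ≥0).coe_nonneg]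
  · have hrr : ((r.toNNReal : ℝ≥0) : ℝ) = r := Real.coe_toNNReal _ hr
    have hle1 : ((r.toNNReal : ℝ≥0) : WithTop ℝ≥0) ≤ σs ↔ r ≤ ((σs.untopA : ℝ≥0) : ℝ) := by
      rw [← WithTop.le_untopA_iff hσ', ← NNReal.coe_le_coe, hrr]
    have hle2 : ((r.toNNReal : ℝ≥0) : WithTop ℝ≥0) ≤ T ω ↔ r ≤ (((T ω).untopA : ℝ≥0) : ℝ) := by
      rw [← WithTop.le_untopA_iff hT', ← NNReal.coe_le_coe, hrr]
    by_cases h1 : r ≤ ((σs.untopA : ℝ≥0) : ℝ)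
    · by_cases h2 : r ≤ (((T ω).untopA : ℝ≥0) : ℝ)
      · rw [if_pos (hle1.2 h1), if_pos (hle2.2 h2), sub_self, mul_zero, indicator_of_notMem]
        exact fun h ↦ absurd h.1 (not_lt.2 h2)
      · rw [if_pos (hle1.2 h1), if_neg (fun h ↦ h2 (hle2.1 h)), sub_zero, indicator_of_mem]
        exact ⟨not_le.1 h2, h1⟩
    · have h2 : ¬ r ≤ (((T ω).untopA : ℝ≥0) : ℝ) := fun h ↦ h1 (h.trans
        (untopA_le_untopA_of_le (hTσ ω) hσ'))
      rw [if_neg (fun h ↦ h1 (hle1.1 h)), if_neg (fun h ↦ h2 (hle2.1 h)), sub_self, mul_zero,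
        indicator_of_notMem]
      exact fun h ↦ h1 h.2

/-- The path `r ↦ φ(r⁺)` is continuous. [folklore] -/
theorem continuous_sleOccRate_toNNReal (hz : 0 < z.im) (ω : ℝ≥0 → ℝ) :
    Continuous fun r : ℝ ↦ sleOccRate κ z S n ℓ r.toNNReal ω :=
  (continuous_sleOccRate hz ℓ ω).comp continuous_real_toNNReal

/-- **`∫₀ᵗ β(r⁺) dr = ∫_{T}^{clamp t} μ φ`**, `clamp t = max T (min t σ⋆)` (real `t`). [folklore] -/
theorem integral_sleOccBeta_eq (hTσ : ∀ ω, T ω ≤ sleStarTime κ z S n ω) (ω : ℝ≥0 → ℝ) (t : ℝ) :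
    ∫ r in (0 : ℝ)..t, sleOccBeta κ z S n ℓ μ T r.toNNReal ω =
      ∫ r in (((T ω).untopA : ℝ≥0) : ℝ)..(max (((T ω).untopA : ℝ≥0) : ℝ)
        (min t (((sleStarTime κ z S n ω).untopA : ℝ≥0) : ℝ))), μ * sleOccRate κ z S n ℓ r.toNNReal ω := by
  simp_rw [sleOccBeta_toNNReal_eq hTσ ω]
  exact integral_indicator_eq_clamp ((T ω).untopA : ℝ≥0).coe_nonneg μ t

/-- `0 ≤ ∫₀ᵗ β(r⁺) dr ≤ μ · 4((n+2)/Im z)² · (n + 1)` for `μ ≥ 0`. [folklore] -/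
theorem integral_sleOccBeta_mem (hz : 0 < z.im) (hμ : 0 ≤ μ)
    (hTσ : ∀ ω, T ω ≤ sleStarTime κ z S n ω) (ω : ℝ≥0 → ℝ) (t : ℝ) :
    (∫ r in (0 : ℝ)..t, sleOccBeta κ z S n ℓ μ T r.toNNReal ω) ∈
      Icc 0 (μ * (4 * ((n + 2) / z.im) ^ 2) * ((n : ℝ) + 1)) := by
  set a : ℝ := (((T ω).untopA : ℝ≥0) : ℝ) with ha
  set b : ℝ := (((sleStarTime κ z S n ω).untopA : ℝ≥0) : ℝ) with hb
  have hab : a ≤ b := untopA_le_untopA_of_le (hTσ ω) (sleStarTime_ne_top ω)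
  have hbN : b ≤ (n : ℝ) + 1 := by
    have := untopA_le_untopA_of_le (sleStarTime_le_succ (κ := κ) (z := z) (S := S) (n := n) ω)
      WithTop.coe_ne_top
    rw [untopA_coe] at this
    push_cast at this
    exact this
  have ha0 : 0 ≤ a := ((T ω).untopA : ℝ≥0).coe_nonneg
  rw [integral_sleOccBeta_eq hTσ ω t]
  have hle : a ≤ max a (min t b) := le_max_left _ _
  have hlen : max a (min t b) - a ≤ (n : ℝ) + 1 := by
    have : max a (min t b) ≤ b := max_le hab (min_le_right _ _)
    linarith
  have hbound : ∀ r ∈ Icc a (max a (min t b)), μ * sleOccRate κ z S n ℓ r.toNNReal ω ∈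
      Icc 0 (μ * (4 * ((n + 2) / z.im) ^ 2)) := fun r _ ↦
    ⟨mul_nonneg hμ (sleOccRate_nonneg _ _ _), mul_le_mul_of_nonneg_left (sleOccRate_le hz _ _ _) hμ⟩
  have hnn : 0 ≤ ∫ r in a..max a (min t b), μ * sleOccRate κ z S n ℓ r.toNNReal ω :=
    intervalIntegral.integral_nonneg hle fun r hr ↦ (hbound r hr).1
  refine ⟨hnn, ?_⟩
  have h1 := intervalIntegral.norm_integral_le_of_norm_le_const (a := a) (b := max a (min t b))
    (C := μ * (4 * ((n + 2) / z.im) ^ 2)) (f := fun r ↦ μ * sleOccRate κ z S n ℓ r.toNNReal ω)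
    fun r hr ↦ by
      rw [uIoc_of_le hle] at hr
      rw [Real.norm_eq_abs, abs_of_nonneg (hbound r ⟨hr.1.le, hr.2⟩).1]
      exact (hbound r ⟨hr.1.le, hr.2⟩).2
  rw [Real.norm_eq_abs, abs_of_nonneg hnn, abs_of_nonneg (by linarith)] at h1
  have hC : 0 ≤ μ * (4 * ((n + 2) / z.im) ^ 2) := by positivity
  exact h1.trans (mul_le_mul_of_nonneg_left hlen hC)

/-- **`E` solves `E_t = 1 + ∫₀ᵗ β E` pathwise** (`integral_indicator_mul_exp_eq`). [folklore] -/
theorem sleOccExp_eq (hz : 0 < z.im) (hTσ : ∀ ω, T ω ≤ sleStarTime κ z S n ω) (ω : ℝ≥0 → ℝ)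
    (t : ℝ≥0) :
    sleOccExp κ z S n ℓ μ T t ω = 1 + ∫ s in (0 : ℝ)..t,
      sleOccBeta κ z S n ℓ μ T s.toNNReal ω * sleOccExp κ z S n ℓ μ T s.toNNReal ω := by
  set a : ℝ := (((T ω).untopA : ℝ≥0) : ℝ) with ha
  set b : ℝ := (((sleStarTime κ z S n ω).untopA : ℝ≥0) : ℝ) with hb
  have ha0 : 0 ≤ a := ((T ω).untopA : ℝ≥0).coe_nonneg
  set ind : ℝ → ℝ := (Ioc a b).indicator (fun r ↦ μ * sleOccRate κ z S n ℓ r.toNNReal ω) with hind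
  have hβ : ∀ r : ℝ, sleOccBeta κ z S n ℓ μ T r.toNNReal ω = ind r := sleOccBeta_toNNReal_eq hTσ ω
  have hE : ∀ s : ℝ, 0 ≤ s → sleOccExp κ z S n ℓ μ T s.toNNReal ω = Real.exp (∫ r in (0 : ℝ)..s, ind r) := by
    intro s hs
    rw [sleOccExp_apply, Real.coe_toNNReal _ hs]
    simp_rw [hβ]
  have hcongr : (∫ s in (0 : ℝ)..t, sleOccBeta κ z S n ℓ μ T s.toNNReal ω *
      sleOccExp κ z S n ℓ μ T s.toNNReal ω) =
      ∫ s in (0 : ℝ)..t, ind s * Real.exp (∫ r in (0 : ℝ)..s, ind r) := by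
    refine integral_congr fun s hs ↦ ?_
    rw [uIcc_of_le t.coe_nonneg] at hs
    show _ = ind s * Real.exp (∫ r in (0 : ℝ)..s, ind r)
    rw [hβ s, hE s hs.1]
  rw [hcongr, integral_indicator_mul_exp_eq (continuous_sleOccRate_toNNReal hz ω) ha0 μ t.coe_nonneg]
  have := hE t t.coe_nonneg
  rw [Real.toNNReal_coe] at this
  rw [this]
  ring

/-- `E` is strongly adapted. [folklore] -/
theorem stronglyAdapted_sleOccExp (hz : 0 < z.im) (hT : IsStoppingTime brownianFiltration T) :
    StronglyAdapted brownianFiltration (sleOccExp κ z S n ℓ μ T) := fun t ↦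
  (Real.measurable_exp.comp (adapted_timeIntegral (isStronglyProgressive_sleOccBeta hz hT) t)).stronglyMeasurable

/-- `E` has continuous paths. [folklore] -/
theorem continuous_sleOccExp (hz : 0 < z.im) (hT : IsStoppingTime brownianFiltration T) (hμ : 0 ≤ μ)
    (hTσ : ∀ ω, T ω ≤ sleStarTime κ z S n ω) (ω : ℝ≥0 → ℝ) :
    Continuous fun t ↦ sleOccExp κ z S n ℓ μ T t ω := by
  have h := continuous_timeIntegral (g := sleOccBeta κ z S n ℓ μ T) (ω := ω) fun t ↦
    integrableOn_Icc_of_abs_le (isStronglyProgressive_sleOccBeta hz hT) (abs_sleOccBeta_le hz hμ hTσ) ω t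
  exact Real.continuous_exp.comp h

/-- `0 < E ≤ exp(μ · 4((n+2)/Im z)² · (n+1))`. [folklore] -/
theorem sleOccExp_mem (hz : 0 < z.im) (hμ : 0 ≤ μ) (hTσ : ∀ ω, T ω ≤ sleStarTime κ z S n ω)
    (t : ℝ≥0) (ω : ℝ≥0 → ℝ) :
    sleOccExp κ z S n ℓ μ T t ω ∈ Icc 1 (Real.exp (μ * (4 * ((n + 2) / z.im) ^ 2) * ((n : ℝ) + 1))) := by
  have h := integral_sleOccBeta_mem (ℓ := ℓ) hz hμ hTσ ω t
  rw [sleOccExp_apply]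
  exact ⟨by simpa using Real.exp_le_exp.2 h.1, Real.exp_le_exp.2 h.2⟩

/-- `E_T = 1`. [folklore] -/
theorem sleOccExp_stoppingTime (hTσ : ∀ ω, T ω ≤ sleStarTime κ z S n ω) (ω : ℝ≥0 → ℝ) :
    sleOccExp κ z S n ℓ μ T (T ω).untopA ω = 1 := by
  rw [sleOccExp_apply, integral_sleOccBeta_eq hTσ]
  have : max (((T ω).untopA : ℝ≥0) : ℝ) (min (((T ω).untopA : ℝ≥0) : ℝ)
      (((sleStarTime κ z S n ω).untopA : ℝ≥0) : ℝ)) = (((T ω).untopA : ℝ≥0) : ℝ) :=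
    max_eq_left (min_le_left _ _)
  rw [this, integral_same, Real.exp_zero]

/-- **`E_{n+1} = exp(μ · Occ_T)`**: at time `n + 1 ≥ σ⋆` the exponential functional has accumulated
exactly the occupation after `T`. [folklore] -/
theorem sleOccExp_succ (ω : ℝ≥0 → ℝ) :
    sleOccExp κ z S n ℓ μ T ((n : ℝ≥0) + 1) ω = Real.exp (μ * sleOccAfter κ z S n ℓ T ω) := by
  rw [sleOccExp_apply, sleOccAfter]
  simp_rw [sleOccBeta_apply]
  rw [intervalIntegral.integral_const_mul]
  push_cast
  ring_nf

/-- **`Occ_T = ∫_T^{σ⋆} φ(r⁺) dr`** (`T ≤ σ⋆`). [folklore] -/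
theorem sleOccAfter_eq_integral (hTσ : ∀ ω, T ω ≤ sleStarTime κ z S n ω) (ω : ℝ≥0 → ℝ) :
    sleOccAfter κ z S n ℓ T ω = ∫ r in (((T ω).untopA : ℝ≥0) : ℝ)..(((sleStarTime κ z S n ω).untopA
      : ℝ≥0) : ℝ), sleOccRate κ z S n ℓ r.toNNReal ω := by
  set a : ℝ := (((T ω).untopA : ℝ≥0) : ℝ) with ha
  set b : ℝ := (((sleStarTime κ z S n ω).untopA : ℝ≥0) : ℝ) with hb
  have hab : a ≤ b := untopA_le_untopA_of_le (hTσ ω) (sleStarTime_ne_top ω)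
  have hbN : b ≤ (n : ℝ) + 1 := by
    have := untopA_le_untopA_of_le (sleStarTime_le_succ (κ := κ) (z := z) (S := S) (n := n) ω)
      WithTop.coe_ne_top
    rw [untopA_coe] at this
    push_cast at this
    exact this
  have h1 : sleOccAfter κ z S n ℓ T ω = ∫ r in (0 : ℝ)..((n : ℝ) + 1), sleOccBeta κ z S n ℓ 1 T r.toNNReal ω := by
    rw [sleOccAfter]
    refine integral_congr fun r _ ↦ ?_
    rw [sleOccBeta_apply, one_mul]
  rw [h1, integral_sleOccBeta_eq hTσ ω, min_eq_right hbN, max_eq_right hab]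
  refine integral_congr fun r _ ↦ ?_
  exact one_mul _

/-- `Occ_T` is measurable. [folklore] -/
theorem measurable_sleOccAfter (hz : 0 < z.im) (hT : IsStoppingTime brownianFiltration T) :
    Measurable (sleOccAfter κ z S n ℓ T) := by
  have hφ := isStronglyProgressive_sleOccRate (κ := κ) (S := S) (n := n) hz ℓ
  have h1 := isStronglyProgressive_trunc hφ fun t ↦ (isStoppingTime_sleStarTime (κ := κ) (z := z)
    (S := S) (n := n) hz).measurableSet_lt t
  have h2 := isStronglyProgressive_trunc hφ fun t ↦ hT.measurableSet_lt t
  have h := adapted_timeIntegral (h1.sub h2) ((n : ℝ≥0) + 1)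
  have heq : sleOccAfter κ z S n ℓ T = timeIntegral (fun r ω ↦ trunc (sleStarTime κ z S n)
      (sleOccRate κ z S n ℓ) r ω - trunc T (sleOccRate κ z S n ℓ) r ω) ((n : ℝ≥0) + 1) := by
    funext ω
    rw [sleOccAfter, timeIntegral]
    push_cast
    rfl
  rw [heq]
  exact h.mono (brownianFiltration.le _) le_rfl

/-- **Exponential tail of the occupation of the levels `≳ ℓ` after `T`.** Let `0 < κ < 8`, `z ∈ ℍ`,
`|w₀| < S`, `T ≤ σ⋆` a stopping time, `G ∈ 𝓕_T`, `ℓ > 0`, `μ_ℓ = ℓ²/C_κ` (`occRateConst`). Then for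
every real `c`,
`exp(μ_ℓ c) · P(G ∩ {Occ_T ≥ c}) ≤ 2 P(G)`,  `Occ_T = ∫_T^{σ⋆} g_ℓ(w_r) y_r⁻² dr` (`sleOccAfter`).
Proof: with `V = 1 + μ_ℓ U_ℓ ∈ [1, 2]`, `(A + μ_ℓ g_ℓ θ) V ≤ 0` (`slopeGen_occSuper_add_le`), the process
`Z_t = V(w_{t∧σ⋆}) exp(∫₀ᵗ β)`, `β = μ_ℓ φ 𝟙_{(T, σ⋆]}`, has non-positive drift
(`exists_martingale_slopeFunctional`), so optional stopping between `T` and `n + 1`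
(`setIntegral_stoppedValue_sub_eq_zero`) gives `∫_G Z_{n+1} ≤ ∫_G Z_T = ∫_G V(w_T) ≤ 2 P(G)`, while
`Z_{n+1} ≥ exp(μ_ℓ Occ_T)`. (Khas\'minskii-type bound.) [folklore] -/
theorem measureReal_inter_occupation_le (hκ : 0 < κ) (hκ8 : κ < 8) (hz : 0 < z.im)
    (h0 : |z.re / z.im| < S) {T : (ℝ≥0 → ℝ) → WithTop ℝ≥0} (hT : IsStoppingTime brownianFiltration T)
    (hTσ : ∀ ω, T ω ≤ sleStarTime κ z S n ω) {G : Set (ℝ≥0 → ℝ)}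
    (hG : MeasurableSet[hT.measurableSpace] G) {ℓ : ℝ} (hℓ : 0 < ℓ) (c : ℝ) :
    Real.exp (occRateConst κ ℓ * c) *
        preWienerMeasure.real (G ∩ {ω | c ≤ sleOccAfter κ z S n ℓ T ω}) ≤
      2 * preWienerMeasure.real G := by
  haveI := isProbabilityMeasure_preWienerMeasure'
  set P := preWienerMeasure with hP
  set σs := sleStarTime κ z S n with hσs
  set w := sleStarSlope κ z S n with hw
  set μ := occRateConst κ ℓ with hμ
  set V := occSuper κ ℓ with hV
  set E := sleOccExp κ z S n ℓ μ T with hE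
  set β := sleOccBeta κ z S n ℓ μ T with hβ
  have hμ0 : 0 ≤ μ := (occRateConst_pos hκ hκ8 hℓ).le
  have hσ := isStoppingTime_sleStarTime (κ := κ) (S := S) (n := n) hz
  have hσρ : ∀ ω, σs ω ≤ slePointLocTime κ z n ω := sleStarTime_le_locTime
  have hSb : ∀ (ω : ℝ≥0 → ℝ) (t : ℝ≥0), (t : WithTop ℝ≥0) ≤ σs ω → |cotArg (sleDriving κ ω) z t| ≤ S :=
    abs_cotArg_le_of_le_sleStarTime hz h0
  have hwp : IsStronglyProgressive brownianFiltration w := isStronglyProgressive_sleStopSlope hz hσ hσρ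
  have hGm : MeasurableSet G := hG.1
  have hVC : ContDiff ℝ 2 V := contDiff_two_occSuper hκ
  have hEa : StronglyAdapted brownianFiltration E := stronglyAdapted_sleOccExp hz hT
  have hEc : ∀ ω, Continuous (E · ω) := continuous_sleOccExp hz hT hμ0 hTσ
  have hEp : IsStronglyProgressive brownianFiltration E := hEa.isStronglyProgressive_of_continuous hEc
  have hβp : IsStronglyProgressive brownianFiltration β := isStronglyProgressive_sleOccBeta hz hT
  have hβbd := abs_sleOccBeta_le (ℓ := ℓ) hz hμ0 hTσ
  set CE : ℝ := Real.exp (μ * (4 * ((n + 2) / z.im) ^ 2) * ((n : ℝ) + 1)) with hCE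
  have hEmem : ∀ t ω, E t ω ∈ Icc 1 CE := fun t ω ↦ sleOccExp_mem hz hμ0 hTσ t ω
  have hEbd : ∀ t ω, |E t ω| ≤ CE := fun t ω ↦ by
    rw [abs_of_pos (zero_lt_one.trans_le (hEmem t ω).1)]; exact (hEmem t ω).2
  have hEeq : ∀ ω (t : ℝ≥0), E t ω = 1 + ∫ s in (0 : ℝ)..t, β s.toNNReal ω * E s.toNNReal ω :=
    fun ω t ↦ sleOccExp_eq hz hTσ ω t
  -- Itô decomposition of `Z = V(w) E`
  obtain ⟨K, hKM, hKc, hK0, hae⟩ := exists_martingale_slopeFunctional (κ := κ) (F := V) hz hσ hσρ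
    hSb hVC hEa hEc hβp hβbd hEbd hEeq
  have hDint : ∀ (ω : ℝ≥0 → ℝ) (a b : ℝ≥0), IntervalIntegrable
      (fun s : ℝ ↦ slopeFunctionalDrift κ z σs V E β s.toNNReal ω) volume a b := fun ω a b ↦
    intervalIntegrable_slopeFunctionalDrift (κ := κ) (F := V) hz hσ hσρ hSb hVC hEa hEc hβp hβbd hEbd ω a b
  -- the drift is non-positive
  have hD : ∀ s ω, slopeFunctionalDrift κ z σs V E β s ω ≤ 0 := by
    intro s ω
    have hEpos : 0 < E s ω := zero_lt_one.trans_le (hEmem s ω).1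
    have hY := sleStarIm_pos (κ := κ) (S := S) (n := n) hz s ω
    have hV1 := one_le_occSuper hκ hκ8 hℓ (w s ω)
    have hg := bandRate_nonneg ℓ (w s ω)
    rw [slopeFunctionalDrift_apply, trunc_apply]
    show (if (s : WithTop ℝ≥0) ≤ σs ω then (sleStarIm κ z S n s ω)⁻¹ ^ 2 * slopeGen κ V (w s ω) else 0) *
        E s ω + V (w s ω) * (β s ω * E s ω) ≤ 0
    rw [show β s ω = μ * (trunc σs (sleOccRate κ z S n ℓ) s ω - trunc T (sleOccRate κ z S n ℓ) s ω)
      from rfl, trunc_apply, trunc_apply]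
    have key := fun (θ : ℝ) (h0 : 0 ≤ θ) (h1 : θ ≤ 1) ↦
      slopeGen_occSuper_add_le hκ hκ8 hℓ (w s ω) (θ := θ) h0 h1
    have hφ : sleOccRate κ z S n ℓ s ω = bandRate ℓ (w s ω) * (sleStarIm κ z S n s ω)⁻¹ ^ 2 := rfl
    split_ifs with h1 h2 h2
    · -- `s ≤ σ⋆`, `s ≤ T`: `β = 0`
      have := key 0 le_rfl zero_le_one
      rw [sub_self, mul_zero, zero_mul, mul_zero, add_zero]
      have h3 : slopeGen κ V (w s ω) ≤ 0 := by simpa using this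
      exact mul_nonpos_of_nonpos_of_nonneg (mul_nonpos_of_nonneg_of_nonpos (sq_nonneg _) h3) hEpos.le
    · -- `T < s ≤ σ⋆`: `β = μ φ`
      have := key 1 zero_le_one le_rfl
      rw [sub_zero, hφ]
      have h3 : (sleStarIm κ z S n s ω)⁻¹ ^ 2 * slopeGen κ V (w s ω) * E s ω +
          V (w s ω) * (μ * (bandRate ℓ (w s ω) * (sleStarIm κ z S n s ω)⁻¹ ^ 2) * E s ω) =
          ((sleStarIm κ z S n s ω)⁻¹ ^ 2 * E s ω) *
            (slopeGen κ V (w s ω) + V (w s ω) * (μ * bandRate ℓ (w s ω) * 1)) := by ring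
      rw [h3]
      exact mul_nonpos_of_nonneg_of_nonpos (by positivity) this
    · -- impossible ordering, but the bound holds anyway: `β = -μφ ≤ 0`
      rw [zero_sub, zero_mul, zero_add, hφ]
      have h3 : V (w s ω) * (μ * -(bandRate ℓ (w s ω) * (sleStarIm κ z S n s ω)⁻¹ ^ 2) * E s ω) =
          -(V (w s ω) * μ * bandRate ℓ (w s ω) * (sleStarIm κ z S n s ω)⁻¹ ^ 2 * E s ω) := by ring
      rw [h3, neg_nonpos]
      have hV0 : 0 ≤ V (w s ω) := zero_le_one.trans hV1
      positivity
    · simp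
  -- the stopping times `T ≤ n + 1`
  set N : ℝ≥0 := (n : ℝ≥0) + 1 with hN
  have hTN : ∀ ω, T ω ≤ (N : WithTop ℝ≥0) := fun ω ↦ (hTσ ω).trans (sleStarTime_le_succ ω)
  have hTne : ∀ ω, T ω ≠ ⊤ := fun ω ↦ ne_top_of_le_ne_top WithTop.coe_ne_top (hTN ω)
  have hNst : IsStoppingTime brownianFiltration (fun _ : ℝ≥0 → ℝ ↦ (N : WithTop ℝ≥0)) :=
    isStoppingTime_const _ _
  have hOS := setIntegral_stoppedValue_sub_eq_zero hKM hKc hK0 hT hNst hTN (fun _ ↦ le_rfl) hG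
  -- pathwise: `Z_{N} - Z_T ≤ K_N - K_T`, `Z_T = V(w_T)`, `Z_N = V(w_N) exp(μ Occ)`
  have hpath : ∀ᵐ ω ∂P, V (w N ω) * Real.exp (μ * sleOccAfter κ z S n ℓ T ω) - V (w (T ω).untopA ω) ≤
      K N ω - K (T ω).untopA ω := by
    filter_upwards [hae] with ω hω
    have h2 := hω N
    have h1 := hω (T ω).untopA
    have hET : E (T ω).untopA ω = 1 := sleOccExp_stoppingTime hTσ ω
    have hEN : E N ω = Real.exp (μ * sleOccAfter κ z S n ℓ T ω) := sleOccExp_succ ω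
    rw [hET, mul_one] at h1
    rw [hEN] at h2
    have hle : (((T ω).untopA : ℝ≥0) : ℝ) ≤ N := by
      have := untopA_le_untopA_of_le (hTN ω) WithTop.coe_ne_top
      rw [untopA_coe] at this
      exact this
    have hsplit := integral_add_adjacent_intervals (hDint ω 0 (T ω).untopA) (hDint ω (T ω).untopA N)
    have hneg : (∫ s in (((T ω).untopA : ℝ≥0) : ℝ)..N, slopeFunctionalDrift κ z σs V E β s.toNNReal ω) ≤ 0 := by
      have := intervalIntegral.integral_nonneg (μ := volume) hle
        (f := fun s ↦ -slopeFunctionalDrift κ z σs V E β s.toNNReal ω) fun s _ ↦ neg_nonneg.2 (hD _ ω)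
      rw [intervalIntegral.integral_neg] at this
      linarith
    have hNN : (((N : WithTop ℝ≥0).untopA : ℝ≥0) : ℝ) = N := rfl
    rw [NNReal.coe_zero] at hsplit
    change V (w N ω) * Real.exp (μ * sleOccAfter κ z S n ℓ T ω) =
      V (z.re / z.im) + (∫ s in (0 : ℝ)..N, slopeFunctionalDrift κ z σs V E β s.toNNReal ω) + K N ω at h2
    linarith
  -- integrability
  have hVc : Continuous V := hVC.continuous
  have hV2 : ∀ v, V v ≤ 2 := occSuper_le_two hκ hκ8 hℓ
  have hV1 : ∀ v, 1 ≤ V v := one_le_occSuper hκ hκ8 hℓ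
  have hOccm : Measurable (sleOccAfter κ z S n ℓ T) := measurable_sleOccAfter hz hT
  have hZNm : Measurable fun ω ↦ V (w N ω) * Real.exp (μ * sleOccAfter κ z S n ℓ T ω) :=
    (hVc.measurable.comp ((hwp.stronglyAdapted N).measurable.mono (brownianFiltration.le _) le_rfl)).mul
      (Real.measurable_exp.comp (measurable_const.mul hOccm))
  have hZNbd : ∀ ω, ‖V (w N ω) * Real.exp (μ * sleOccAfter κ z S n ℓ T ω)‖ ≤ 2 * CE := by
    intro ω
    have hEN : E N ω = Real.exp (μ * sleOccAfter κ z S n ℓ T ω) := sleOccExp_succ ω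
    rw [← hEN, Real.norm_eq_abs, abs_mul, abs_of_nonneg (zero_le_one.trans (hV1 _))]
    exact mul_le_mul (hV2 _) (hEbd N ω) (abs_nonneg _) (by norm_num)
  have hZNint : Integrable (fun ω ↦ V (w N ω) * Real.exp (μ * sleOccAfter κ z S n ℓ T ω)) P :=
    Integrable.of_bound hZNm.aestronglyMeasurable _ (ae_of_all _ hZNbd)
  have hZTm : Measurable fun ω ↦ V (w (T ω).untopA ω) :=
    hVc.measurable.comp (measurable_stoppedValue' hwp hT)
  have hZTint : Integrable (fun ω ↦ V (w (T ω).untopA ω)) P :=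
    Integrable.of_bound hZTm.aestronglyMeasurable 2 (ae_of_all _ fun ω ↦ by
      rw [Real.norm_eq_abs, abs_of_nonneg (zero_le_one.trans (hV1 _))]; exact hV2 _)
  have hKint₁ := integrable_stoppedValue_of_martingale hKM hKc hT hTN
  have hKint₂ := integrable_stoppedValue_of_martingale hKM hKc hNst (fun _ ↦ le_rfl)
  -- `∫_G Z_N ≤ ∫_G V(w_T) ≤ 2 P(G)`
  have hstep : ∫ ω in G, V (w N ω) * Real.exp (μ * sleOccAfter κ z S n ℓ T ω) ∂P ≤ 2 * P.real G := by
    have h1 : ∫ ω in G, (V (w N ω) * Real.exp (μ * sleOccAfter κ z S n ℓ T ω) - V (w (T ω).untopA ω)) ∂P ≤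
        ∫ ω in G, (K N ω - K (T ω).untopA ω) ∂P :=
      setIntegral_mono_ae (hZNint.sub hZTint).integrableOn (hKint₂.sub hKint₁).integrableOn hpath
    have hOS' : ∫ ω in G, (K N ω - K (T ω).untopA ω) ∂P = 0 := hOS
    rw [hOS', integral_sub hZNint.integrableOn hZTint.integrableOn] at h1
    have h2 : ∫ ω in G, V (w (T ω).untopA ω) ∂P ≤ ∫ ω in G, (2 : ℝ) ∂P :=
      setIntegral_mono_on hZTint.integrableOn (integrable_const _).integrableOn hGm fun ω _ ↦ hV2 _
    rw [setIntegral_const, smul_eq_mul, mul_comm] at h2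
    linarith
  -- assemble
  have hCm : MeasurableSet {ω | c ≤ sleOccAfter κ z S n ℓ T ω} := measurableSet_le measurable_const hOccm
  calc Real.exp (μ * c) * P.real (G ∩ {ω | c ≤ sleOccAfter κ z S n ℓ T ω})
      = ∫ ω in G ∩ {ω | c ≤ sleOccAfter κ z S n ℓ T ω}, Real.exp (μ * c) ∂P := by
        rw [setIntegral_const, smul_eq_mul, mul_comm]
    _ ≤ ∫ ω in G ∩ {ω | c ≤ sleOccAfter κ z S n ℓ T ω},
          V (w N ω) * Real.exp (μ * sleOccAfter κ z S n ℓ T ω) ∂P := by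
        refine setIntegral_mono_on (integrable_const _).integrableOn hZNint.integrableOn (hGm.inter hCm)
          fun ω hω ↦ ?_
        calc Real.exp (μ * c) ≤ Real.exp (μ * sleOccAfter κ z S n ℓ T ω) :=
              Real.exp_le_exp.2 (mul_le_mul_of_nonneg_left hω.2 hμ0)
          _ ≤ V (w N ω) * Real.exp (μ * sleOccAfter κ z S n ℓ T ω) :=
              le_mul_of_one_le_left (Real.exp_pos _).le (hV1 _)
    _ ≤ ∫ ω in G, V (w N ω) * Real.exp (μ * sleOccAfter κ z S n ℓ T ω) ∂P :=
        setIntegral_mono_set hZNint.integrableOn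
          (ae_of_all _ fun ω ↦ mul_nonneg (zero_le_one.trans (hV1 _)) (Real.exp_pos _).le)
          (ae_of_all _ inter_subset_left)
    _ ≤ 2 * P.real G := hstep

end Occ

end Literature.Probability.RandomPlanarGeometry
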